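import Summits.BirchSwinnertonDyer.Rank1Residual.X2.GreenbergVatsalTateFrobeniusSign
import Summits.BirchSwinnertonDyer.Rank1Residual.X2.CyclotomicDecompositionCount
import Literature.NumberTheory.EllipticCurves.KodairaNeronUnramifiedInertiaProofs
import Literature.NumberTheory.Automorphic.AdicCompletionResidueCard
import Literature.NumberTheory.GaloisRepresentations.LocalGaloisGroupFrobeniusProofs
import HarnessLib

/-!
# `K_v(√γ)/K_v` at a place `v ∤ 2` where `γ = −a/b` with `a, b ∈ ℤ` units at `v`:
# inertia FIXES `√γ`, and a Frobenius FLIPS it when `(−ab)^{(Nv−1)/2} ≡ −1`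

Cell `bsd-eis` (home `run/shared/lean/pub/bsd-eis/`), seat `bsd-line-x1-p1-w2` (D-0154 width seat on
crux 2 `GoodLatticeBDPValue` = stmt-BirchSwinnertonDyer-19032, line `halves`, stub `stub_imprimCorank`,
`f`-side conjunct `rem142_goodLattice_selmerAc_imprimitive`), file F3b-local: the two LOCAL ARITHMETIC
inputs `hI` / `hF` of `SelmerAcMultiplicativePlaceSign.zpCorank_le_of_hasMultiplicativeReductionAt_of_sign`
(p614431), over the completion `K_v` of an arbitrary number field at a finite place `v ∤ 2`, for
`γ = −a/b` with INTEGERS `a, b` prime to `v` — the shape met by `E ×_ℚ K` (`c₄, c₆ ∈ ℤ` of the global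
minimal model of `E/ℚ`, `v`-units at a multiplicative place).  This is the port from `ℚ_ℓ` to `K_v` of
b2b X2 `GreenbergVatsalTateDatumRat.inertia_fix_sqrt_gamma` and
`GreenbergVatsalTateFrobeniusSign.frob_smul_sqrt_gamma_eq_neg` (same valuation argument with the
spectral valuation `|·|_v` on `K̄_v`; the Frobenius congruence is read off `IsFrobPow φ 1` directly,
exponent `q_v = Nv`):

* `toAlgEquiv_sqrt_eq_of_mem_absInertia` — `σ t = t` for `σ ∈ I_{K_v}`, `t² = γ`: `|t|_v = 1`,
  `σ t = ±t`, and `σ t = −t` would give `|σt − t|_v = |2t|_v = 1`, not `< 1`;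
* `smul_sqrt_eq_neg_of_isFrobPow_one` — `φ t = −t` for `IsFrobPow φ 1` when `Nv` is odd and
  `ℓ ∣ (−ab)^{(Nv−1)/2} + 1` (`v ∣ ℓ`): with `t' = bt`, `t'² = −ab`, `φ t' ≡ t'^{Nv} = t'(−ab)^{(Nv−1)/2}
  ≡ −t'`, and `φ t = t` would give `|2t'|_v < 1`; `toAlgEquiv_sqrt_ne_of_isFrobPow_one` (`φ t ≠ t`);
* `inertia_fix_sqrt_gamma_of_c₄_eq_intCast`, `exists_isFrobPow_one_apply_sqrt_gamma_ne_of_c₄_eq_intCast` —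
  the same packaged in the exact hypothesis shapes `hI`, `hF` of p614431 for a curve `W/K` with
  `W.c₄ = a`, `W.c₆ = b`.

HONEST FRAMING: tool lemmas (local algebra only; no definition, no named fact, no `sorry`); close nothing
by themselves (`--supports stmt-BirchSwinnertonDyer-19032`); BSD / Mazur's main conjecture is proved for
no curve.  Left to the sequel: the instantiation at `E ×_ℚ K`, `w ∣ ℓ ‖ N_E` of degree one (Euler's
criterion supplies `ℓ ∣ (−c₄c₆)^{(ℓ−1)/2} + 1` at a non-split `ℓ`: X2
`int_dvd_pow_div_two_add_one_of_not_split`), the places above `2`, and the final sum.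

References: Silverman *ATAEC* V.5.2–5.4, Ex. 5.11; Silverman *AEC* VII.5.1 (b); Greenberg–Vatsal 2000 §2
pp. 14–15; Neukirch *ANT* II (4.8), (6.2), (9.3).
-/

-- `Summit.BirchSwinnertonDyer.BirchSwinnertonDyer.…`: summit and sub-problem share a name (D-0017 layout).
set_option linter.dupNamespace false
set_option autoImplicit false

noncomputable section

open scoped Classical NNReal

open NumberField IsDedekindDomain Field ValuativeRel
open Literature.NumberTheory.EllipticCurves Literature.NumberTheory.GaloisRepresentations
  Literature.NumberTheory.GaloisRepresentations.IsNonarchimedeanLocalField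
  IsDedekindDomain.HeightOneSpectrum

namespace Summit.BirchSwinnertonDyer.BirchSwinnertonDyer.Theorems.SqrtGammaUnramifiedSign

variable {K : Type} [Field K] [NumberField K] {v : HeightOneSpectrum (𝓞 K)}

/-- `γ = −a/b` read in `K̄_v`. [folklore] -/
theorem algebraMap_neg_div_intCast (a b : ℤ) :
    algebraMap (v.adicCompletion K) (AlgebraicClosure (v.adicCompletion K))
        (algebraMap K (v.adicCompletion K) (-((a : K) / (b : K)))) =
      -((a : AlgebraicClosure (v.adicCompletion K)) / (b : AlgebraicClosure (v.adicCompletion K))) := by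
  rw [← IsScalarTower.algebraMap_apply K (v.adicCompletion K) (AlgebraicClosure (v.adicCompletion K)),
    map_neg, map_div₀, map_intCast, map_intCast]

/-- `σ t = ±t` whenever `t² ∈ K_v`. [folklore] -/
theorem smul_eq_or_eq_neg_of_sq_eq {γ : v.adicCompletion K} {t : AlgebraicClosure (v.adicCompletion K)}
    (ht : t ^ 2 = algebraMap (v.adicCompletion K) (AlgebraicClosure (v.adicCompletion K)) γ)
    (σ : absoluteGaloisGroup (v.adicCompletion K)) : σ • t = t ∨ σ • t = -t := by
  have hsq : (σ • t) ^ 2 = t ^ 2 := by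
    rw [Field.absoluteGaloisGroup.smul_def, ← map_pow, ht, AlgEquiv.commutes]
  have h0 : (σ • t - t) * (σ • t + t) = 0 := by
    have : (σ • t - t) * (σ • t + t) = (σ • t) ^ 2 - t ^ 2 := by ring
    rw [this, hsq, sub_self]
  rcases mul_eq_zero.mp h0 with h | h
  · exact Or.inl (sub_eq_zero.mp h)
  · exact Or.inr (eq_neg_of_add_eq_zero_left h)

/-- `|t|_v = 1` for `t² = −a/b` with `a, b` integers prime to `v`. [folklore] -/
theorem spectralValuation_sqrt_eq_one {w : Valuation (AlgebraicClosure (v.adicCompletion K)) ℝ≥0}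
    (hw : ∀ x, (w x : ℝ) = spectralNorm (v.adicCompletion K) (AlgebraicClosure (v.adicCompletion K)) x)
    {a b : ℤ} (ha : (a : 𝓞 K) ∉ v.asIdeal) (hb : (b : 𝓞 K) ∉ v.asIdeal)
    {t : AlgebraicClosure (v.adicCompletion K)}
    (ht : t ^ 2 = algebraMap (v.adicCompletion K) (AlgebraicClosure (v.adicCompletion K))
        (algebraMap K (v.adicCompletion K) (-((a : K) / (b : K))))) : w t = 1 := by
  have hwa : w (a : AlgebraicClosure (v.adicCompletion K)) = 1 := spectralValuation_intCast_eq_one hw ha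
  have hwb : w (b : AlgebraicClosure (v.adicCompletion K)) = 1 := spectralValuation_intCast_eq_one hw hb
  have hwt2 : w t ^ 2 = 1 := by
    rw [← map_pow, ht, algebraMap_neg_div_intCast, Valuation.map_neg, map_div₀, hwa, hwb, div_one]
  rcases lt_trichotomy (w t) 1 with h | h | h
  · exact absurd hwt2 (ne_of_lt (pow_lt_one₀ zero_le h two_ne_zero))
  · exact h
  · exact absurd hwt2 (ne_of_gt (one_lt_pow₀ h two_ne_zero))

/-- `|2|_v = 1` at a place `v ∤ 2`. [folklore] -/
theorem spectralValuation_two_eq_one {w : Valuation (AlgebraicClosure (v.adicCompletion K)) ℝ≥0}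
    (hw : ∀ x, (w x : ℝ) = spectralNorm (v.adicCompletion K) (AlgebraicClosure (v.adicCompletion K)) x)
    (h2 : (2 : 𝓞 K) ∉ v.asIdeal) : w (2 : AlgebraicClosure (v.adicCompletion K)) = 1 := by
  have h2' : ((2 : ℤ) : 𝓞 K) ∉ v.asIdeal := by exact_mod_cast h2
  have h := spectralValuation_intCast_eq_one hw h2'
  exact_mod_cast h

/-- **Inertia fixes `√γ` at `v ∤ 2` when `γ = −a/b` with `a, b ∈ ℤ` prime to `v`** (`K_v(√γ)/K_v` is
unramified; Silverman *ATAEC* V Ex. 5.11, the inertial half): `|t|_v = 1`, `σ t = ±t` for every `σ`,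
and for `σ ∈ I_{K_v}` `|σ t − t|_v < 1` (Neukirch II (9.3)) while `σ t = −t` would give
`|σt − t|_v = |2t|_v = 1`.  Port of b2b X2 `GreenbergVatsalTateDatumRat.inertia_fix_sqrt_gamma` from
`ℚ_ℓ` to `K_v`. [cite: SilvermanATAEC1994, Ch. V Lemma 5.2 (c), Thm. 5.3 (a),(b), Cor. 5.4 (held copy PDF pp. 406–410)]
[cite: NeukirchANT1999, Ch. II §9 Prop. (9.9) (exactness at G(λ|κ))] -/
theorem toAlgEquiv_sqrt_eq_of_mem_absInertia {a b : ℤ} (ha : (a : 𝓞 K) ∉ v.asIdeal)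
    (hb : (b : 𝓞 K) ∉ v.asIdeal) (h2 : (2 : 𝓞 K) ∉ v.asIdeal)
    (t : AlgebraicClosure (v.adicCompletion K))
    (ht : t ^ 2 = algebraMap (v.adicCompletion K) (AlgebraicClosure (v.adicCompletion K))
        (algebraMap K (v.adicCompletion K) (-((a : K) / (b : K)))))
    {σ : absoluteGaloisGroup (v.adicCompletion K)} (hσ : σ ∈ absInertia (v.adicCompletion K)) :
    Field.absoluteGaloisGroup.toAlgEquiv (v.adicCompletion K) σ t = t := by
  obtain ⟨w, hw⟩ := v.exists_spectralValuation
  have hwt : w t = 1 := spectralValuation_sqrt_eq_one hw ha hb ht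
  -- inertia moves `t` by less than `1`
  obtain ⟨𝔐, h𝔐⟩ := v.localPrimesAbove_nonempty
  have hσ' : σ ∈ 𝔐.inertia (absoluteGaloisGroup (v.adicCompletion K)) := by
    rw [inertia_eq_absInertia hw h𝔐]; exact hσ
  have hlt : w (σ • t - t) < 1 := (mem_inertia_iff_spectralValuation hw h𝔐).1 hσ' t hwt.le
  rcases smul_eq_or_eq_neg_of_sq_eq ht σ with h | h
  · exact h
  · exfalso
    have hrew : σ • t - t = -((2 : AlgebraicClosure (v.adicCompletion K)) * t) := by rw [h]; ring
    rw [hrew, Valuation.map_neg, map_mul, spectralValuation_two_eq_one hw h2, hwt, one_mul] at hlt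
    exact lt_irrefl _ hlt

/-- **A Frobenius FLIPS `√γ`** (`γ = −a/b`, `a, b ∈ ℤ` prime to `v`, `v ∤ 2`, `v ∣ ℓ`, `Nv` odd and
`ℓ ∣ (−ab)^{(Nv−1)/2} + 1` — at a degree-one `v` this is Euler's criterion for the non-square `−ab`
mod `ℓ`, i.e. `E` NON-split multiplicative at `ℓ`): every `φ ∈ Γ_{K_v}` with `IsFrobPow φ 1`
(`φ x ≡ x^{Nv}` on the absolute integers) has `φ t = −t`.  Proof: `t' = bt` is a `v`-adic unit with
`t'² = g = −ab ∈ ℤ`; `φ t' ≡ t'^{Nv} = t' · g^{(Nv−1)/2} ≡ −t'`, so `|φ t' + t'|_v < 1`; and `φ t = ±t`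
with `φ t = t` forcing `|2t'|_v < 1`, absurd at `v ∤ 2`.  Port of b2b X2
`GreenbergVatsalTateFrobeniusSign.frob_smul_sqrt_gamma_eq_neg` from `ℚ_ℓ` to `K_v` (`K_v(√γ)` is the
unramified QUADRATIC extension; GV's `φ(Frob) = −1`).
[cite: SilvermanATAEC1994, Ch. V Lemma 5.2 (c), Thm. 5.3 (a),(b), Cor. 5.4 (held copy PDF pp. 406–410)]
[cite: SilvermanAEC2009, VII.5 Prop. 5.1(b)] [cite: GreenbergVatsal2000, §2 pp. 14–15] -/
theorem smul_sqrt_eq_neg_of_isFrobPow_one {a b : ℤ} (ha : (a : 𝓞 K) ∉ v.asIdeal)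
    (hb : (b : 𝓞 K) ∉ v.asIdeal) (h2 : (2 : 𝓞 K) ∉ v.asIdeal) {ℓ : ℕ} (hℓ : (ℓ : 𝓞 K) ∈ v.asIdeal)
    (hodd : ¬ 2 ∣ v.asIdeal.absNorm)
    (hg : (ℓ : ℤ) ∣ (-(a * b)) ^ (v.asIdeal.absNorm / 2) + 1)
    {φ : absoluteGaloisGroup (v.adicCompletion K)} (hφ : IsFrobPow φ 1)
    (t : AlgebraicClosure (v.adicCompletion K))
    (ht : t ^ 2 = algebraMap (v.adicCompletion K) (AlgebraicClosure (v.adicCompletion K))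
        (algebraMap K (v.adicCompletion K) (-((a : K) / (b : K))))) :
    φ • t = -t := by
  obtain ⟨w, hw⟩ := v.exists_spectralValuation
  haveI : CharZero (AlgebraicClosure (v.adicCompletion K)) :=
    charZero_of_injective_algebraMap (algebraMap K (AlgebraicClosure (v.adicCompletion K))).injective
  have hb0 : (b : AlgebraicClosure (v.adicCompletion K)) ≠ 0 := by
    rw [Int.cast_ne_zero]
    rintro rfl
    exact hb (by rw [Int.cast_zero]; exact Submodule.zero_mem _)
  -- `t' = b t`, `t'² = g = -ab`
  obtain ⟨t', ht'def⟩ : ∃ t' : AlgebraicClosure (v.adicCompletion K),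
      t' = (b : AlgebraicClosure (v.adicCompletion K)) * t := ⟨_, rfl⟩
  have ht'2 : t' ^ 2 = (((-(a * b)) : ℤ) : AlgebraicClosure (v.adicCompletion K)) := by
    rw [ht'def, mul_pow, ht, algebraMap_neg_div_intCast]
    push_cast
    field_simp
  -- valuations: `|b| = |t| = |t'| = 1`
  have hwb : w (b : AlgebraicClosure (v.adicCompletion K)) = 1 := spectralValuation_intCast_eq_one hw hb
  have hwt : w t = 1 := spectralValuation_sqrt_eq_one hw ha hb ht
  have hwt' : w t' = 1 := by rw [ht'def, map_mul, hwb, hwt, one_mul]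
  -- the Frobenius congruence on the absolute integer `t'`, exponent `q_v = Nv`
  have hq : residueFieldCard (v.adicCompletion K) = v.asIdeal.absNorm := by
    rw [Literature.NumberTheory.Automorphic.residueFieldCard_adicCompletion_eq]; rfl
  have ht'mem : t' ∈ absIntegers 𝒪[v.adicCompletion K] (v.adicCompletion K) :=
    mem_absIntegers_iff_algNorm_le_one.2 ((spectralValuation_le_one_iff_algNorm_le_one hw _).1 hwt'.le)
  have hfrob : w (φ • t' - t' ^ v.asIdeal.absNorm) < 1 := by
    have h := (isFrobPow_natCast_iff (n := 1)).1 hφ ⟨t', ht'mem⟩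
    rw [pow_one, hq] at h
    have hlt := mem_absMaximalIdeal_iff_algNorm_lt_one.1 h
    have hlt' : algNorm (v.adicCompletion K) (φ • t' - t' ^ v.asIdeal.absNorm) < 1 := hlt
    rwa [← spectralValuation_lt_one_iff_algNorm_lt_one hw] at hlt'
  -- Euler: `t'^{Nv} = t' * g^{(Nv-1)/2} = t' * (ℓ k) - t'`
  obtain ⟨k, hk⟩ := hg
  have hNodd : v.asIdeal.absNorm = 2 * (v.asIdeal.absNorm / 2) + 1 :=
    (Nat.two_mul_div_two_add_one_of_odd (Nat.odd_iff.2 (Nat.two_dvd_ne_zero.1 hodd))).symm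
  have htp : t' ^ v.asIdeal.absNorm = t' * ((ℓ : AlgebraicClosure (v.adicCompletion K)) *
      (k : AlgebraicClosure (v.adicCompletion K))) - t' := by
    have e1 : t' ^ v.asIdeal.absNorm = t' * (t' ^ 2) ^ (v.asIdeal.absNorm / 2) := by
      conv_lhs => rw [hNodd]
      rw [pow_succ, pow_mul, mul_comm]
    have e2 : ((((-(a * b)) : ℤ) : AlgebraicClosure (v.adicCompletion K))) ^ (v.asIdeal.absNorm / 2) =
        (ℓ : AlgebraicClosure (v.adicCompletion K)) * (k : AlgebraicClosure (v.adicCompletion K)) - 1 := by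
      have := congrArg (fun z : ℤ ↦ (z : AlgebraicClosure (v.adicCompletion K))) hk
      push_cast at this ⊢
      linear_combination this
    rw [e1, ht'2, e2]; ring
  -- hence `|φ t' + t'| < 1`
  have hwℓ : w (ℓ : AlgebraicClosure (v.adicCompletion K)) < 1 :=
    IsDedekindDomain.HeightOneSpectrum.spectralValuation_natCast_lt_one hw hℓ
  have hwk : w (k : AlgebraicClosure (v.adicCompletion K)) ≤ 1 :=
    (mem_localAbsIntegers_iff_spectralValuation hw).1 (intCast_mem v.localAbsIntegers k)
  have hsum : w (φ • t' + t') < 1 := by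
    have e : φ • t' + t' = (φ • t' - t' ^ v.asIdeal.absNorm) +
        t' * ((ℓ : AlgebraicClosure (v.adicCompletion K)) * (k : AlgebraicClosure (v.adicCompletion K))) := by
      rw [htp]; ring
    rw [e]
    refine lt_of_le_of_lt (Valuation.map_add w _ _) (max_lt hfrob ?_)
    rw [map_mul, hwt', one_mul, map_mul]
    calc w (ℓ : AlgebraicClosure (v.adicCompletion K)) * w (k : AlgebraicClosure (v.adicCompletion K))
        ≤ w (ℓ : AlgebraicClosure (v.adicCompletion K)) * 1 := by gcongr
      _ < 1 := by rw [mul_one]; exact hwℓ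
  -- `φ t = ± t`, and `φ t = t` is absurd
  have hφb : φ • (b : AlgebraicClosure (v.adicCompletion K)) = (b : AlgebraicClosure (v.adicCompletion K)) := by
    rw [Field.absoluteGaloisGroup.smul_def, map_intCast]
  rcases smul_eq_or_eq_neg_of_sq_eq ht φ with h | h
  · exfalso
    have hφt' : φ • t' = t' := by rw [ht'def, smul_mul', hφb, h]
    rw [hφt', ← two_mul, map_mul, spectralValuation_two_eq_one hw h2, hwt', one_mul] at hsum
    exact lt_irrefl _ hsum
  · exact h

/-- The same with Mathlib's `AlgEquiv` spelling and as a non-fixedness statement (`t ≠ 0`):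
`toAlgEquiv φ t ≠ t`, the shape consumed by `SelmerAcMultiplicativePlaceSign` (`hF`, `ε = −1`).
[cite: GreenbergVatsal2000, §2 pp. 14–15] -/
theorem toAlgEquiv_sqrt_ne_of_isFrobPow_one {a b : ℤ} (ha : (a : 𝓞 K) ∉ v.asIdeal)
    (hb : (b : 𝓞 K) ∉ v.asIdeal) (h2 : (2 : 𝓞 K) ∉ v.asIdeal) {ℓ : ℕ} (hℓ : (ℓ : 𝓞 K) ∈ v.asIdeal)
    (hodd : ¬ 2 ∣ v.asIdeal.absNorm)
    (hg : (ℓ : ℤ) ∣ (-(a * b)) ^ (v.asIdeal.absNorm / 2) + 1)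
    {φ : absoluteGaloisGroup (v.adicCompletion K)} (hφ : IsFrobPow φ 1)
    (t : AlgebraicClosure (v.adicCompletion K)) (ht0 : t ≠ 0)
    (ht : t ^ 2 = algebraMap (v.adicCompletion K) (AlgebraicClosure (v.adicCompletion K))
        (algebraMap K (v.adicCompletion K) (-((a : K) / (b : K))))) :
    Field.absoluteGaloisGroup.toAlgEquiv (v.adicCompletion K) φ t ≠ t := by
  rw [← Field.absoluteGaloisGroup.smul_def, smul_sqrt_eq_neg_of_isFrobPow_one ha hb h2 hℓ hodd hg hφ t ht]
  haveI : CharZero (AlgebraicClosure (v.adicCompletion K)) :=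
    charZero_of_injective_algebraMap (algebraMap K (AlgebraicClosure (v.adicCompletion K))).injective
  intro h
  have h2t : (2 : AlgebraicClosure (v.adicCompletion K)) * t = 0 := by linear_combination -h
  rcases mul_eq_zero.mp h2t with h' | h'
  · exact two_ne_zero h'
  · exact ht0 h'

/-! ## Packaged in the hypothesis shapes `hI` / `hF` of `SelmerAcMultiplicativePlaceSign` -/

/-- **`hI` for a curve with `c₄ = a`, `c₆ = b` integers prime to `v ∤ 2`**: inertia of `K_v` fixes
every square root of `γ = −c₄/c₆` in `K̄_v`.
[cite: SilvermanATAEC1994, Ch. V Lemma 5.2 (c), Thm. 5.3 (a),(b), Cor. 5.4 (held copy PDF pp. 406–410)] -/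
theorem inertia_fix_sqrt_gamma_of_c₄_eq_intCast (W : WeierstrassCurve K) {a b : ℤ}
    (h4 : W.c₄ = a) (h6 : W.c₆ = b) (ha : (a : 𝓞 K) ∉ v.asIdeal) (hb : (b : 𝓞 K) ∉ v.asIdeal)
    (h2 : (2 : 𝓞 K) ∉ v.asIdeal) :
    ∀ t : AlgebraicClosure (v.adicCompletion K),
      t ^ 2 = algebraMap (v.adicCompletion K) (AlgebraicClosure (v.adicCompletion K))
        (algebraMap K (v.adicCompletion K) (-(W.c₄ / W.c₆))) →
      ∀ σ ∈ absInertia (v.adicCompletion K),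
        Field.absoluteGaloisGroup.toAlgEquiv (v.adicCompletion K) σ t = t := by
  intro t ht σ hσ
  rw [h4, h6] at ht
  exact toAlgEquiv_sqrt_eq_of_mem_absInertia ha hb h2 t ht hσ

/-- **`hF` (`ε = −1`) for a curve with `c₄ = a`, `c₆ = b` integers prime to `v ∤ 2`, `v ∣ ℓ`, `Nv` odd,
`ℓ ∣ (−ab)^{(Nv−1)/2} + 1`**: some `φ` with `IsFrobPow φ 1` (they exist: `exists_isFrobPow_holds`) moves
every non-zero square root of `γ = −c₄/c₆`. [cite: GreenbergVatsal2000, §2 pp. 14–15]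
[cite: SilvermanAEC2009, VII.5 Prop. 5.1(b)] -/
theorem exists_isFrobPow_one_apply_sqrt_gamma_ne_of_c₄_eq_intCast (W : WeierstrassCurve K) {a b : ℤ}
    (h4 : W.c₄ = a) (h6 : W.c₆ = b) (ha : (a : 𝓞 K) ∉ v.asIdeal) (hb : (b : 𝓞 K) ∉ v.asIdeal)
    (h2 : (2 : 𝓞 K) ∉ v.asIdeal) {ℓ : ℕ} (hℓ : (ℓ : 𝓞 K) ∈ v.asIdeal) (hodd : ¬ 2 ∣ v.asIdeal.absNorm)
    (hg : (ℓ : ℤ) ∣ (-(a * b)) ^ (v.asIdeal.absNorm / 2) + 1) :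
    ∀ t : AlgebraicClosure (v.adicCompletion K), t ≠ 0 →
      t ^ 2 = algebraMap (v.adicCompletion K) (AlgebraicClosure (v.adicCompletion K))
        (algebraMap K (v.adicCompletion K) (-(W.c₄ / W.c₆))) →
      ∃ φ : absoluteGaloisGroup (v.adicCompletion K), IsFrobPow φ 1 ∧
        Field.absoluteGaloisGroup.toAlgEquiv (v.adicCompletion K) φ t ≠ t := by
  intro t ht0 ht
  rw [h4, h6] at ht
  obtain ⟨φ, hφ⟩ := exists_isFrobPow_holds (F := v.adicCompletion K) 1
  exact ⟨φ, hφ, toAlgEquiv_sqrt_ne_of_isFrobPow_one ha hb h2 hℓ hodd hg hφ t ht0 ht⟩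

end Summit.BirchSwinnertonDyer.BirchSwinnertonDyer.Theorems.SqrtGammaUnramifiedSign

end
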